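import Summits.Parity.GeneralizedHardyLittlewood.Theorems.LiouvilleShiftedTablesSieveToMAvgBoxes
import Literature.NumberTheory.Sieve.ParityBarrier

/-!
# Sieve glue for `SieveToMAvg`, part 6a: Type II — removing the cross-condition

Support file for item stmt-Parity-14274 (route `LiouvilleShiftedTables`).  For a bilinear piece
`α ⋆ β` (with `α` supported on `[1, A₂]`) the correlation sum of part 1 with the weight
`w(n) = λ(n − h)` is

  `∑_{x < ab ≤ 2x, ab ≡ h (q)} α_a β_b λ(ab − h)`.

Cutting `a` into the fine boxes `(A₂(1+Δ₁)^{−k−1}, A₂(1+Δ₁)^{−k}]` (`Literature.NumberTheory.Sieve.BFI.boxRestrict`)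
and replacing, on the `k`-th box `(lo, hi]`, the hyperbolic condition `x < ab ≤ 2x` by
`x/lo < b ≤ 2x/hi` costs only the pairs with `ab` in the two slivers `(x, (1+Δ₁)x]`,
`(2x/(1+Δ₁), 2x]`.  Result (`TT_mul_le`):

  `TT(α ⋆ β) ≤ ∑_{q} ∑_{k} |main_{k,q}| + ∑_{q} ∑_{n ∈ slivers, n ≡ h (q)} (|α| ⋆ |β|)(n)`,

where `main_{k,q}` is a genuine bilinear form (rows = the box, columns = an interval), estimated
in part 6b through the fourth moment of the class-restricted tables (`DilatedTableChowla`).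
-/

namespace Summit.Parity.GeneralizedHardyLittlewood.Theorems.SieveToMAvg

open Finset Real
open scoped ArithmeticFunction.zeta ArithmeticFunction.sigma
open Literature.NumberTheory.Sieve.BFI

/-! ### The weight `λ(n − h)` -/

/-- The weight `w(n) = λ(n − h)` (Liouville function of `Int.toNat (n − h)`, so `λ(0) = 0` below `h`). [folklore] -/
noncomputable def lamW (h : ℕ) (n : ℕ) : ℝ :=
  (ArithmeticFunction.liouville (Int.toNat ((n : ℤ) - h)) : ℝ)

/-- `|w(n)| ≤ 1`. [folklore] -/
theorem abs_lamW_le_one (h n : ℕ) : |lamW h n| ≤ 1 := Literature.NumberTheory.Sieve.abs_liouville_le_one _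

/-! ### Opening the convolution -/

/-- The truncated, filtered weight `cc(n) = 1_{⌊x⌋ < n ≤ N} 1_{n ≡ h (q)} λ(n−h)`. [folklore] -/
noncomputable def cc (h q : ℕ) (x : ℝ) (N n : ℕ) : ℝ :=
  if ⌊x⌋₊ < n ∧ n ≤ N ∧ n ≡ h [MOD q] then lamW h n else 0

/-- **The correlation sum of a convolution as a double sum**: with `N = ⌊2x⌋`,
`corr (λ(·−h)) h q x (α ⋆ β) = ∑_{a ≤ N} ∑_{b ≤ N} α_a β_b cc(ab)`. [folklore] -/
theorem corr_mul_eq (h q : ℕ) (x : ℝ) (α β : ArithmeticFunction ℝ) :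
    corr (lamW h) h q x (fun n => (α * β) n) =
      ∑ a ∈ Ioc 0 ⌊2 * x⌋₊, ∑ b ∈ Ioc 0 ⌊2 * x⌋₊, α a * β b * cc h q x ⌊2 * x⌋₊ (a * b) := by
  set N := ⌊2 * x⌋₊ with hN
  -- Step 1: `corr = ∑_{n ∈ Ioc 0 N} (α*β) n * c n`
  have h1 : corr (lamW h) h q x (fun n => (α * β) n) =
      ∑ n ∈ Ioc 0 N, (α * β) n * cc h q x N n := by
    unfold corr dyadClass
    rw [Finset.sum_filter]
    have hsub : Ioc ⌊x⌋₊ N ⊆ Ioc 0 N := fun n hn => by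
      rw [Finset.mem_Ioc] at hn ⊢; omega
    rw [← Finset.sum_subset hsub]
    · refine Finset.sum_congr rfl fun n hn => ?_
      rw [Finset.mem_Ioc] at hn
      unfold cc
      by_cases hm : n ≡ h [MOD q]
      · rw [if_pos hm, if_pos ⟨hn.1, hn.2, hm⟩]
      · rw [if_neg hm, if_neg (fun h' => hm h'.2.2), mul_zero]
    · intro n hn hn'
      rw [Finset.mem_Ioc] at hn
      unfold cc
      rw [if_neg, mul_zero]
      rintro ⟨h1, h2, -⟩
      exact hn' (Finset.mem_Ioc.2 ⟨h1, h2⟩)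
  rw [h1, sum_Ioc_mul_apply_mul, Finset.sum_filter, Finset.sum_product]
  refine Finset.sum_congr rfl fun a _ => Finset.sum_congr rfl fun b _ => ?_
  split_ifs with hab
  · rfl
  · unfold cc
    rw [if_neg (fun h' => hab h'.2.1), mul_zero]

/-! ### Fine boxes in the `a`-variable -/

section Pieces

variable (h q : ℕ) (x A₂ Δ₁ : ℝ) (α β : ArithmeticFunction ℝ)

/-- The `k`-th piece `corr_k = ∑_a ∑_b (boxRestrict A₂ Δ₁ k α)(a) β(b) cc(ab)`. [folklore] -/
noncomputable def corrPiece (k : ℕ) : ℝ :=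
  ∑ a ∈ Ioc 0 ⌊2 * x⌋₊, ∑ b ∈ Ioc 0 ⌊2 * x⌋₊, boxRestrict A₂ Δ₁ k α a * β b * cc h q x ⌊2 * x⌋₊ (a * b)

/-- The column predicate of the `k`-th piece: `x < lo_k · b` and `hi_k · b ≤ 2x`. [folklore] -/
def colOK (k b : ℕ) : Prop := x < boxLow A₂ Δ₁ k * b ∧ boxHigh A₂ Δ₁ k * b ≤ 2 * x

/-- `colOK` is decidable (classically). [folklore] -/
noncomputable instance instDecidableColOK (k b : ℕ) : Decidable (colOK x A₂ Δ₁ k b) := by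
  unfold colOK; infer_instance

/-- The main part of the `k`-th piece: columns restricted to `colOK`, where the cross-condition is
automatic, so only the congruence remains:
`main_k = ∑_{a} ∑_{b : colOK} 1_{ab ≡ h (q)} α_k(a) β(b) λ(ab − h)`. [folklore] -/
noncomputable def mainPiece (k : ℕ) : ℝ :=
  ∑ a ∈ Ioc 0 ⌊2 * x⌋₊, ∑ b ∈ Ioc 0 ⌊2 * x⌋₊,
    if colOK x A₂ Δ₁ k b ∧ a * b ≡ h [MOD q] then boxRestrict A₂ Δ₁ k α a * β b * lamW h (a * b) else 0

/-- The sliver predicate: `n ≤ (1+Δ₁)x` or `2x/(1+Δ₁) < n`. [folklore] -/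
def Sliver (n : ℕ) : Prop := (n : ℝ) ≤ (1 + Δ₁) * x ∨ 2 * x / (1 + Δ₁) < n

/-- `Sliver` is decidable (classically). [folklore] -/
noncomputable instance instDecidableSliver (n : ℕ) : Decidable (Sliver x Δ₁ n) := by
  unfold Sliver; infer_instance

variable {h q x A₂ Δ₁ α β}

/-- **Splitting `corr` into pieces**: if `α` is supported on `a ≤ A₂`, `0 < A₂ < (1+Δ₁)^{K₁}`,
`Δ₁ > 0`, then `corr = ∑_{k<K₁} corr_k`. [folklore] -/
theorem corr_mul_eq_sum_corrPiece (hA₂ : 0 < A₂) (hΔ₁ : 0 < Δ₁) {K₁ : ℕ} (hK₁ : A₂ < (1 + Δ₁) ^ K₁)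
    (hα : ∀ a : ℕ, α a ≠ 0 → (a : ℝ) ≤ A₂) :
    corr (lamW h) h q x (fun n => (α * β) n) = ∑ k ∈ Finset.range K₁, corrPiece h q x A₂ Δ₁ α β k := by
  rw [corr_mul_eq]
  unfold corrPiece
  set N := ⌊2 * x⌋₊
  symm
  calc ∑ k ∈ Finset.range K₁, ∑ a ∈ Ioc 0 N, ∑ b ∈ Ioc 0 N, boxRestrict A₂ Δ₁ k α a * β b * cc h q x N (a * b)
      = ∑ a ∈ Ioc 0 N, ∑ k ∈ Finset.range K₁, ∑ b ∈ Ioc 0 N, boxRestrict A₂ Δ₁ k α a * β b * cc h q x N (a * b) :=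
        Finset.sum_comm
    _ = ∑ a ∈ Ioc 0 N, ∑ b ∈ Ioc 0 N, ∑ k ∈ Finset.range K₁, boxRestrict A₂ Δ₁ k α a * β b * cc h q x N (a * b) :=
        Finset.sum_congr rfl fun a _ => Finset.sum_comm
    _ = ∑ a ∈ Ioc 0 N, ∑ b ∈ Ioc 0 N, α a * β b * cc h q x N (a * b) := by
        refine Finset.sum_congr rfl fun a ha => Finset.sum_congr rfl fun b _ => ?_
        rw [← Finset.sum_mul, ← Finset.sum_mul]
        congr 2
        by_cases hα0 : α a = 0
        · rw [hα0]
          refine Finset.sum_eq_zero fun k _ => ?_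
          rw [boxRestrict_apply]; split_ifs <;> simp [hα0]
        · have ha1 : 1 ≤ a := (Finset.mem_Ioc.1 ha).1
          exact sum_boxRestrict_apply hA₂ hΔ₁ hK₁ α ha1 (hα a hα0)

/-- On the `k`-th box, a column `b` with `colOK k b` satisfies the cross-condition automatically:
`⌊x⌋ < ab ≤ ⌊2x⌋`. [folklore] -/
theorem cross_of_colOK (hx : 0 ≤ x) {k a b : ℕ} (ha : InBox A₂ Δ₁ k a) (hb : colOK x A₂ Δ₁ k b) :
    ⌊x⌋₊ < a * b ∧ a * b ≤ ⌊2 * x⌋₊ := by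
  obtain ⟨_, hlo, hhi⟩ := ha
  obtain ⟨hb1, hb2⟩ := hb
  have hb0 : (0 : ℝ) ≤ b := Nat.cast_nonneg b
  have hxab : x < (a : ℝ) * b := by
    rcases eq_or_lt_of_le hb0 with hb00 | hbpos
    · rw [← hb00, mul_zero] at hb1; linarith
    · calc x < boxLow A₂ Δ₁ k * b := hb1
        _ ≤ (a : ℝ) * b := mul_le_mul_of_nonneg_right hlo.le hb0
  have hab2 : (a : ℝ) * b ≤ 2 * x :=
    calc (a : ℝ) * b ≤ boxHigh A₂ Δ₁ k * b := mul_le_mul_of_nonneg_right hhi hb0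
      _ ≤ 2 * x := hb2
  constructor
  · exact (Nat.floor_lt hx).2 (by push_cast; exact hxab)
  · exact Nat.le_floor (by push_cast; exact hab2)

/-- Off `colOK`, a pair `(a, b)` of the `k`-th box has `ab` in a sliver (below `(1+Δ₁)x` or above
`2x/(1+Δ₁)`; `Δ₁ > 0`). [folklore] -/
theorem sliver_of_not_colOK (hΔ₁ : 0 < Δ₁) {k a b : ℕ} (ha : InBox A₂ Δ₁ k a)
    (hb : ¬ colOK x A₂ Δ₁ k b) : Sliver x Δ₁ (a * b) := by
  obtain ⟨_, hlo, hhi⟩ := ha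
  have hΔ' : (-1 : ℝ) < Δ₁ := by linarith
  rw [boxHigh_eq_mul_boxLow hΔ'] at hhi
  have hb0 : (0 : ℝ) ≤ b := Nat.cast_nonneg b
  have hlopos : 0 < boxLow A₂ Δ₁ k := by
    have h0 : (0 : ℝ) < a := by exact_mod_cast ‹0 < a›
    by_contra hneg
    rw [not_lt] at hneg
    -- then `a ≤ (1+Δ₁) lo ≤ 0`, contradiction
    have : (a : ℝ) ≤ 0 := hhi.trans (mul_nonpos_of_nonneg_of_nonpos (by linarith) hneg) |>.trans le_rfl
    linarith
  unfold colOK at hb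
  unfold Sliver
  rw [not_and_or, not_lt, not_le, boxHigh_eq_mul_boxLow hΔ'] at hb
  push_cast
  rcases hb with hb1 | hb2
  · -- `lo b ≤ x` ⇒ `ab ≤ (1+Δ₁) lo b ≤ (1+Δ₁) x`
    left
    calc (a : ℝ) * b ≤ (1 + Δ₁) * boxLow A₂ Δ₁ k * b := mul_le_mul_of_nonneg_right hhi hb0
      _ = (1 + Δ₁) * (boxLow A₂ Δ₁ k * b) := by ring
      _ ≤ (1 + Δ₁) * x := mul_le_mul_of_nonneg_left hb1 (by linarith)
  · -- `2x < (1+Δ₁) lo b` ⇒ `2x/(1+Δ₁) < lo b ≤ a b`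
    right
    rw [div_lt_iff₀ (by linarith)]
    calc 2 * x < (1 + Δ₁) * boxLow A₂ Δ₁ k * b := hb2
      _ = boxLow A₂ Δ₁ k * b * (1 + Δ₁) := by ring
      _ ≤ (a : ℝ) * b * (1 + Δ₁) := by
          refine mul_le_mul_of_nonneg_right (mul_le_mul_of_nonneg_right hlo.le hb0) (by linarith)

/-- **Piece = main + sliver error**:
`|corr_k − main_k| ≤ ∑_a ∑_b 1_{ab ∈ sliver ∩ dyadClass} |α_k(a)| |β(b)|`. [folklore] -/
theorem abs_corrPiece_sub_mainPiece_le (hx : 0 ≤ x) (hΔ₁ : 0 < Δ₁) (k : ℕ) :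
    |corrPiece h q x A₂ Δ₁ α β k - mainPiece h q x A₂ Δ₁ α β k| ≤
      ∑ a ∈ Ioc 0 ⌊2 * x⌋₊, ∑ b ∈ Ioc 0 ⌊2 * x⌋₊,
        if Sliver x Δ₁ (a * b) ∧ (⌊x⌋₊ < a * b ∧ a * b ≤ ⌊2 * x⌋₊ ∧ a * b ≡ h [MOD q]) then
          |boxRestrict A₂ Δ₁ k α a| * |β b| else 0 := by
  unfold corrPiece mainPiece
  rw [← Finset.sum_sub_distrib]
  refine (Finset.abs_sum_le_sum_abs _ _).trans (Finset.sum_le_sum fun a _ => ?_)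
  rw [← Finset.sum_sub_distrib]
  refine (Finset.abs_sum_le_sum_abs _ _).trans (Finset.sum_le_sum fun b _ => ?_)
  -- case analysis on whether `a` is in the box
  by_cases ha : InBox A₂ Δ₁ k a
  · unfold cc
    by_cases hcol : colOK x A₂ Δ₁ k b
    · obtain ⟨h1, h2⟩ := cross_of_colOK hx ha hcol
      by_cases hm : a * b ≡ h [MOD q]
      · rw [if_pos (show ⌊x⌋₊ < a * b ∧ a * b ≤ ⌊2 * x⌋₊ ∧ a * b ≡ h [MOD q] from ⟨h1, h2, hm⟩),
          if_pos (show colOK x A₂ Δ₁ k b ∧ a * b ≡ h [MOD q] from ⟨hcol, hm⟩), sub_self, abs_zero]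
        split_ifs <;> positivity
      · rw [if_neg (show ¬(⌊x⌋₊ < a * b ∧ a * b ≤ ⌊2 * x⌋₊ ∧ a * b ≡ h [MOD q]) from fun h' => hm h'.2.2),
          if_neg (show ¬(colOK x A₂ Δ₁ k b ∧ a * b ≡ h [MOD q]) from fun h' => hm h'.2),
          mul_zero, sub_self, abs_zero]
        split_ifs <;> positivity
    · rw [if_neg (show ¬(colOK x A₂ Δ₁ k b ∧ a * b ≡ h [MOD q]) from fun h' => hcol h'.1), sub_zero]
      by_cases hcr : ⌊x⌋₊ < a * b ∧ a * b ≤ ⌊2 * x⌋₊ ∧ a * b ≡ h [MOD q]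
      · rw [if_pos hcr, if_pos (show Sliver x Δ₁ (a * b) ∧ (⌊x⌋₊ < a * b ∧ a * b ≤ ⌊2 * x⌋₊ ∧ a * b ≡ h [MOD q])
          from ⟨sliver_of_not_colOK hΔ₁ ha hcol, hcr⟩), abs_mul, abs_mul]
        exact mul_le_of_le_one_right (by positivity) (abs_lamW_le_one h _)
      · rw [if_neg hcr, mul_zero, abs_zero]
        split_ifs <;> positivity
  · have h0 : boxRestrict A₂ Δ₁ k α a = 0 := by rw [boxRestrict_apply, if_neg ha]
    simp only [h0, zero_mul, abs_zero]
    rw [ite_self, sub_self, abs_zero]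
    split_ifs <;> simp

/-! ### Summing the sliver errors over the pieces -/

/-- The sliver errors summed over all pieces are bounded by the double sum with `|α|` in place of
the boxed `α_k` (at most one box contains each `a`). [folklore] -/
theorem sum_sliverErr_le (hA₂ : 0 < A₂) (hΔ₁ : 0 ≤ Δ₁) (K₁ : ℕ) :
    ∑ k ∈ Finset.range K₁, ∑ a ∈ Ioc 0 ⌊2 * x⌋₊, ∑ b ∈ Ioc 0 ⌊2 * x⌋₊,
        (if Sliver x Δ₁ (a * b) ∧ (⌊x⌋₊ < a * b ∧ a * b ≤ ⌊2 * x⌋₊ ∧ a * b ≡ h [MOD q]) then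
          |boxRestrict A₂ Δ₁ k α a| * |β b| else 0) ≤
      ∑ a ∈ Ioc 0 ⌊2 * x⌋₊, ∑ b ∈ Ioc 0 ⌊2 * x⌋₊,
        (if Sliver x Δ₁ (a * b) ∧ (⌊x⌋₊ < a * b ∧ a * b ≤ ⌊2 * x⌋₊ ∧ a * b ≡ h [MOD q]) then
          |α a| * |β b| else 0) := by
  rw [Finset.sum_comm]
  refine Finset.sum_le_sum fun a _ => ?_
  rw [Finset.sum_comm]
  refine Finset.sum_le_sum fun b _ => ?_
  by_cases hc : Sliver x Δ₁ (a * b) ∧ (⌊x⌋₊ < a * b ∧ a * b ≤ ⌊2 * x⌋₊ ∧ a * b ≡ h [MOD q])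
  · simp only [if_pos hc]
    rw [← Finset.sum_mul]
    exact mul_le_mul_of_nonneg_right (sum_abs_boxRestrict_le hA₂ hΔ₁ K₁ α a) (abs_nonneg _)
  · simp only [if_neg hc, Finset.sum_const_zero, le_refl]

/-- The double sum of the sliver errors is the sliver part of the correlation range of `|α| ⋆ |β|`:
`∑_a ∑_b 1_{ab ∈ sliver ∩ dyadClass} |α_a| |β_b| = ∑_{n ∈ dyadClass, sliver} (|α| ⋆ |β|)(n)`. [folklore] -/
theorem sum_sum_sliver_eq (h q : ℕ) (x Δ₁ : ℝ) (α β : ArithmeticFunction ℝ) :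
    ∑ a ∈ Ioc 0 ⌊2 * x⌋₊, ∑ b ∈ Ioc 0 ⌊2 * x⌋₊,
        (if Sliver x Δ₁ (a * b) ∧ (⌊x⌋₊ < a * b ∧ a * b ≤ ⌊2 * x⌋₊ ∧ a * b ≡ h [MOD q]) then
          |α a| * |β b| else 0) =
      ∑ n ∈ (dyadClass h q x).filter (fun n => Sliver x Δ₁ n), (absAF α * absAF β) n := by
  set N := ⌊2 * x⌋₊ with hN
  set g : ℕ → ℝ := fun n => if Sliver x Δ₁ n ∧ (⌊x⌋₊ < n ∧ n ≤ N ∧ n ≡ h [MOD q]) then 1 else 0 with hg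
  -- right-hand side as a weighted sum over `Ioc 0 N`
  have hR : ∑ n ∈ (dyadClass h q x).filter (fun n => Sliver x Δ₁ n), (absAF α * absAF β) n =
      ∑ n ∈ Ioc 0 N, (absAF α * absAF β) n * g n := by
    unfold dyadClass
    rw [Finset.filter_filter, Finset.sum_filter]
    have hsub : Ioc ⌊x⌋₊ N ⊆ Ioc 0 N := fun n hn => by rw [Finset.mem_Ioc] at hn ⊢; omega
    rw [← Finset.sum_subset hsub]
    · refine Finset.sum_congr rfl fun n hn => ?_
      rw [Finset.mem_Ioc] at hn
      simp only [hg]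
      by_cases hc : n ≡ h [MOD q] ∧ Sliver x Δ₁ n
      · rw [if_pos hc, if_pos ⟨hc.2, hn.1, hn.2, hc.1⟩, mul_one]
      · rw [if_neg hc, if_neg (fun h' => hc ⟨h'.2.2.2, h'.1⟩), mul_zero]
    · intro n _ hn'
      simp only [hg]
      rw [if_neg, mul_zero]
      rintro ⟨-, h1, h2, -⟩
      exact hn' (Finset.mem_Ioc.2 ⟨h1, h2⟩)
  rw [hR, sum_Ioc_mul_apply_mul, Finset.sum_filter, Finset.sum_product]
  refine Finset.sum_congr rfl fun a _ => Finset.sum_congr rfl fun b _ => ?_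
  simp only [hg, absAF_apply]
  by_cases hc : Sliver x Δ₁ (a * b) ∧ (⌊x⌋₊ < a * b ∧ a * b ≤ N ∧ a * b ≡ h [MOD q])
  · rw [if_pos hc, if_pos hc.2.2.1, if_pos hc, mul_one]
  · rw [if_neg hc]
    split_ifs <;> simp

/-- **Type II, the cross-condition removed**: for `α` supported on `a ≤ A₂` (`0 < A₂ < (1+Δ₁)^{K₁}`,
`Δ₁ > 0`, `x ≥ 0`),
`TT(α ⋆ β) ≤ ∑_{q} ∑_{k<K₁} |main_{k,q}| + ∑_{q} ∑_{n ∈ dyadClass, sliver} (|α| ⋆ |β|)(n)`. [folklore] -/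
theorem TT_mul_le (hx : 0 ≤ x) (hA₂ : 0 < A₂) (hΔ₁ : 0 < Δ₁) {K₁ : ℕ} (hK₁ : A₂ < (1 + Δ₁) ^ K₁)
    (hα : ∀ a : ℕ, α a ≠ 0 → (a : ℝ) ≤ A₂) (Q : ℕ) :
    TT (lamW h) h Q x (fun n => (α * β) n) ≤
      (∑ q ∈ moduli Q h, ∑ k ∈ Finset.range K₁, |mainPiece h q x A₂ Δ₁ α β k|) +
        ∑ q ∈ moduli Q h, ∑ n ∈ (dyadClass h q x).filter (fun n => Sliver x Δ₁ n), (absAF α * absAF β) n := by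
  unfold TT
  rw [← Finset.sum_add_distrib]
  refine Finset.sum_le_sum fun q _ => ?_
  rw [corr_mul_eq_sum_corrPiece hA₂ hΔ₁ hK₁ hα, ← sum_sum_sliver_eq h q x Δ₁ α β]
  have hsplit : ∀ k, corrPiece h q x A₂ Δ₁ α β k =
      mainPiece h q x A₂ Δ₁ α β k + (corrPiece h q x A₂ Δ₁ α β k - mainPiece h q x A₂ Δ₁ α β k) :=
    fun k => by ring
  calc |∑ k ∈ Finset.range K₁, corrPiece h q x A₂ Δ₁ α β k|
      ≤ ∑ k ∈ Finset.range K₁, |corrPiece h q x A₂ Δ₁ α β k| := Finset.abs_sum_le_sum_abs _ _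
    _ ≤ ∑ k ∈ Finset.range K₁, (|mainPiece h q x A₂ Δ₁ α β k| +
          |corrPiece h q x A₂ Δ₁ α β k - mainPiece h q x A₂ Δ₁ α β k|) :=
        Finset.sum_le_sum fun k _ => by
          conv_lhs => rw [hsplit k]
          exact abs_add_le _ _
    _ = (∑ k ∈ Finset.range K₁, |mainPiece h q x A₂ Δ₁ α β k|) +
          ∑ k ∈ Finset.range K₁, |corrPiece h q x A₂ Δ₁ α β k - mainPiece h q x A₂ Δ₁ α β k| :=
        Finset.sum_add_distrib
    _ ≤ (∑ k ∈ Finset.range K₁, |mainPiece h q x A₂ Δ₁ α β k|) +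
          ∑ a ∈ Ioc 0 ⌊2 * x⌋₊, ∑ b ∈ Ioc 0 ⌊2 * x⌋₊,
            (if Sliver x Δ₁ (a * b) ∧ (⌊x⌋₊ < a * b ∧ a * b ≤ ⌊2 * x⌋₊ ∧ a * b ≡ h [MOD q]) then
              |α a| * |β b| else 0) := by
        exact add_le_add le_rfl ((Finset.sum_le_sum fun k _ =>
          abs_corrPiece_sub_mainPiece_le hx hΔ₁ k).trans (sum_sliverErr_le hA₂ hΔ₁.le K₁))

end Pieces

end Summit.Parity.GeneralizedHardyLittlewood.Theorems.SieveToMAvg
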